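import Literature.Geometry.Kaehler.ComplexTorusHodgeGroupRealPointsDense
import Literature.Geometry.Kaehler.ComplexTorusHodgeClassesProductHodgeGroupConverse
import Literature.Geometry.Kaehler.ComplexTorusHodgeGroupProductIrreducible
import HarnessLib

/-!
# Moonen–Zarhin 1999 (3.1) ON COMPLEX POINTS: `Hg(X₁ × X₂)(ℂ) = Hg(X₁)(ℂ) × Hg(X₂)(ℂ)` iff the same holds on real
# points iff the index is finite iff no power `X₁^N × X₂^N` carries an exceptional Hodge class

Layer `Literature/Geometry/Kaehler`, namespace `Literature.Geometry.Kaehler.ComplexTorus`; lane `lit-hodgefound`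
(Track 2 foundations library), Layer A4, self-proposed row «(g14-#1 `ComplexTorusHodgeGroupRealPointsDense`)⁺ ·
(g13-#3 `ComplexTorusHodgeClassesProductHodgeGroupConverse`)⁺ · (p40 `ComplexTorusHodgeGroupProductIrreducible`)⁺» of
`run/shared/lean/pub/lit-hodgefound/SKELETON.md` (prover seat p17, generation 14). For two complex tori `X₁ = E₁/Φ₁(ℤ^ι₁)`,
`X₂ = E₂/Φ₂(ℤ^ι₂)` with product `X₁ × X₂ = (E₁ × E₂)/Φ(ℤ^{ι₁ ⊕ ι₂})`, `Φ = prodPeriod Φ₁ Φ₂`, the tree has four readings of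
"`Hg(X₁ × X₂) = Hg(X₁) × Hg(X₂)`" (`⊆` always holds: `hodgeGroup_prod_le`, `hodgeGroupC_prod_le_blockDiagProd`):

* (ℂ) `hodgeGroupC Φ = blockDiagProd (hodgeGroupC Φ₁) (hodgeGroupC Φ₂)` — complex points;
* (ℝ) `hodgeGroup Φ = ((hodgeGroup Φ₁).prod (hodgeGroup Φ₂)).map (blockDiag ι₁ ι₂)` — real points;
* (fin) `Hg(X₁ × X₂)(ℂ)` has finite index in `Hg(X₁)(ℂ) × Hg(X₂)(ℂ)` (Imai);
* (Hdg) for all `N ≥ 1` and `p` the Hodge classes of `X₁^N × X₂^N` are spanned by the cross products of Hodge classes of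
  `X₁^N` and `X₂^N` — no exceptional Hodge classes (Moonen–Zarhin (3.1)).

Known: (ℂ) ⟺ (fin) (`hodgeGroupC_prod_eq_blockDiagProd_iff_relIndex_ne_zero`, strong connectedness), (fin) ⟹ (ℝ)
(`hodgeGroup_prod_eq_of_relIndex_ne_zero`), (ℝ) ⟺ (Hdg) (`hodgeGroup_prod_eq_iff_forall_hodgeClasses_prod_pow_eq_crossSpan`).
THIS file closes the circle for POLARISED tori: **(ℝ) ⟹ (ℂ)** by the Zariski density of the real points of `Hg(X₁)`
and `Hg(X₂)` (`IsRiemannForm.zariskiClosureSL_map_hodgeGroup`) and "the closure of a product contains the product of the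
closures" (`blockDiagProd_zariskiClosureSL_le`, §1); hence all four are equivalent (§2–§3), in particular **Moonen–Zarhin
(3.1) for the algebraic groups through their (Zariski-dense) complex points** and **"an exceptional Hodge class lives on
some `X₁^N × X₂^N` iff `Hg(X₁ × X₂)(ℂ)` has infinite index in `Hg(X₁)(ℂ) × Hg(X₂)(ℂ)`"**. §4 reads the tree's Künneth
consequences (`ComplexTorusHodgeClassesProductHodgeGroup`: span by cross products, `dim B^p(X₁ × X₂) = Σ dim B^a(X₁)
dim B^b(X₂)`, `D = B` transfers to the product) through complex equality or finite index (every pair of tori).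

## Sources, verbatim

* B. Moonen, Yu. Zarhin, *Hodge classes on abelian varieties of low dimension*, Math. Ann. 315 (1999) (held
  `paper:arxiv-math_9901113`), §3 (3.1) (p0006 L25–L27, L57–L62): "Let `X₁` and `X₂` be complex abelian varieties.
  Write `X = X₁ × X₂`. Then `Hg(X)` is an algebraic subgroup of `Hg(X₁) × Hg(X₂)`"; "We may have that
  `Hg(X₁ × X₂) ≠ Hg(X₁) × Hg(X₂)`. […] This holds if and only if for some `m` and `n` the Hodge ring `B•(X₁^m × X₂^n)` is
  not generated by the elements coming from `B•(X₁^m)` and `B•(X₂^n)`."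
* H. Imai, *On the Hodge groups of some abelian varieties*, Kodai Math. Sem. Rep. 27 (1976), §1 (p. 367):
  "`Hg(A₁ × A₂) ⊂ Hg(A₁) × Hg(A₂)`" and §2 (the finite-index argument).
* T. A. Springer, *Linear Algebraic Groups* (1998), §13.3 Cor. 13.3.9 (ii) (density of `G(F)`, here through
  `ComplexTorusHodgeGroupRealPointsDense`); Thm. 1.5.4 (ii) (products of irreducibles).

Everything is a theorem (no definition, no named fact, net debt 0). NOT here: unpolarised tori for (ℝ) ⟹ (ℂ); the
Lie-algebra criteria (3.2)–(3.8); `r ≥ 3` factors. The Hodge conjecture is not addressed.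

## References

* [MoonenZarhin1999LowDim] B. Moonen, Yu. Zarhin, Math. Ann. 315 (1999) 711–733, §3 (3.1).
* [Imai1976HodgeGroups] H. Imai, Kodai Math. Sem. Rep. 27 (1976) 367–372, §§1–2.
* [Springer1998] T. A. Springer, *Linear Algebraic Groups*, 2nd ed. (1998), Thm. 1.5.4 (ii), Cor. 13.3.9 (ii).
* [Milne2017] J. S. Milne, *Algebraic Groups* (2017), Lemma 1.40, Definition 1.48.
-/

noncomputable section

open scoped Matrix
open Set Function Matrix

namespace Literature.Geometry.Kaehler

namespace ComplexTorus

/-! ## §1 The Zariski closure of a block-diagonal product contains the product of the closures -/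

section Closure

variable {ι₁ ι₂ : Type*} [Fintype ι₁] [Fintype ι₂] [DecidableEq ι₁] [DecidableEq ι₂]
  {H₁ : Subgroup (SpecialLinearGroup ι₁ ℂ)} {H₂ : Subgroup (SpecialLinearGroup ι₂ ℂ)}

/-- A polynomial vanishing on `H₁ × H₂` vanishes on `H̄₁ × H₂`: for fixed `B ∈ H₂`, `F(·, B)` (the tree's
`leftBlockSubst`) vanishes on `H₁`, hence on its Zariski closure. [cite: Milne2017, Lemma 1.40 (proof: translations preserve the vanishing ideal)] [cite: Springer1998, Thm. 1.5.4 (ii) (proof)] -/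
theorem evalMatC_fromBlocks_eq_zero_of_mem_zariskiClosureSL_left {F : MvPolynomial ((ι₁ ⊕ ι₂) × (ι₁ ⊕ ι₂)) ℂ}
    (hF : F ∈ vanishingIdealC (blockDiagProd H₁ H₂)) {A : SpecialLinearGroup ι₁ ℂ} (hA : A ∈ zariskiClosureSL H₁)
    {B : SpecialLinearGroup ι₂ ℂ} (hB : B ∈ H₂) : evalMatC (Matrix.fromBlocks A.1 0 0 B.1) F = 0 := by
  have hleft : leftBlockSubst B.1 F ∈ vanishingIdealC H₁ := by
    refine mem_vanishingIdealC_iff.2 fun A' hA' ↦ ?_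
    rw [evalMatC_leftBlockSubst]
    have h := mem_vanishingIdealC_iff.1 hF _ (blockDiagC_mem_blockDiagProd_iff.2 ⟨hA', hB⟩)
    rwa [coe_blockDiagC] at h
  have h := (mem_zariskiClosureSL_iff.1 hA) _ hleft
  rwa [evalMatC_leftBlockSubst] at h

/-- **`H̄₁ × H̄₂ ≤ (H₁ × H₂)‾`**: the Zariski closure of the block-diagonal product of two subgroups contains the product of
their Zariski closures (fix the left factor in `H̄₁`, then close up the right factor with `rightBlockSubst`).
[cite: Milne2017, Lemma 1.40 and Definition 1.48] [cite: Springer1998, Thm. 1.5.4 (ii) (proof)] -/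
theorem blockDiagProd_zariskiClosureSL_le :
    blockDiagProd (zariskiClosureSL H₁) (zariskiClosureSL H₂) ≤ zariskiClosureSL (blockDiagProd H₁ H₂) := by
  intro M hM
  obtain ⟨A, hA, B, hB, rfl⟩ := mem_blockDiagProd_iff.1 hM
  refine mem_zariskiClosureSL_iff.2 fun F hF ↦ ?_
  have hright : rightBlockSubst A.1 F ∈ vanishingIdealC H₂ := by
    refine mem_vanishingIdealC_iff.2 fun B' hB' ↦ ?_
    rw [evalMatC_rightBlockSubst]
    exact evalMatC_fromBlocks_eq_zero_of_mem_zariskiClosureSL_left hF hA hB'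
  have h := (mem_zariskiClosureSL_iff.1 hB) _ hright
  rw [evalMatC_rightBlockSubst] at h
  rw [coe_blockDiagC]
  exact h

end Closure

/-! ## §2 Real equality implies complex equality (polarised tori) -/

section RealToComplex

variable {ι₁ ι₂ : Type*} [Fintype ι₁] [Fintype ι₂] [DecidableEq ι₁] [DecidableEq ι₂]
  {E₁ E₂ : Type*} [NormedAddCommGroup E₁] [NormedSpace ℂ E₁] [NormedAddCommGroup E₂] [NormedSpace ℂ E₂]
  {Φ₁ : (ι₁ → ℝ) ≃L[ℝ] E₁} {Φ₂ : (ι₂ → ℝ) ≃L[ℝ] E₂}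

variable (Φ₁ Φ₂) in
/-- The block-diagonal product of the real points `Hg(X₁)(ℝ) ⊗ 1 × Hg(X₂)(ℝ) ⊗ 1` is the complexification of the image of
`Hg(X₁)(ℝ) × Hg(X₂)(ℝ)` under the real block-diagonal map. [cite: Imai1976HodgeGroups, §1 (p. 367)] -/
theorem blockDiagProd_map_hodgeGroup_eq :
    blockDiagProd ((hodgeGroup Φ₁).map (SpecialLinearGroup.map Complex.ofRealHom))
        ((hodgeGroup Φ₂).map (SpecialLinearGroup.map Complex.ofRealHom)) =
      (((hodgeGroup Φ₁).prod (hodgeGroup Φ₂)).map (blockDiag ι₁ ι₂)).map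
        (SpecialLinearGroup.map Complex.ofRealHom) := by
  ext M
  rw [mem_blockDiagProd_iff]
  constructor
  · rintro ⟨_, ⟨A, hA, rfl⟩, _, ⟨B, hB, rfl⟩, rfl⟩
    exact Subgroup.mem_map.2 ⟨blockDiag ι₁ ι₂ (A, B), Subgroup.mem_map.2 ⟨(A, B), Subgroup.mem_prod.2 ⟨hA, hB⟩, rfl⟩,
      map_ofRealHom_blockDiag ι₁ ι₂ A B⟩
  · rintro ⟨_, ⟨⟨A, B⟩, hAB, rfl⟩, rfl⟩
    obtain ⟨hA, hB⟩ := Subgroup.mem_prod.1 hAB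
    exact ⟨_, Subgroup.mem_map_of_mem _ hA, _, Subgroup.mem_map_of_mem _ hB, (map_ofRealHom_blockDiag ι₁ ι₂ A B).symm⟩

/-- **(ℝ) ⟹ (ℂ), the density step**: for polarised `X₁`, `X₂`, if `Hg(X₁)(ℝ) × Hg(X₂)(ℝ) ⊆ Hg(X₁ × X₂)(ℝ)` then
`Hg(X₁)(ℂ) × Hg(X₂)(ℂ) ⊆ Hg(X₁ × X₂)(ℂ)` — `Hg(Xᵢ)(ℂ)` is the Zariski closure of `Hg(Xᵢ)(ℝ)` (Springer 13.3.9 (ii) at torus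
level), the product of the closures lies in the closure of the product (§1), and `Hg(X₁ × X₂)(ℂ)` is Zariski closed.
[cite: Springer1998, §13.3 Cor. 13.3.9 (ii)] [cite: MoonenZarhin1999LowDim, §3 (3.1)] -/
theorem IsRiemannForm.blockDiagProd_hodgeGroupC_le_of_prod_le {η₁ : E₁ [⋀^Fin 2]→L[ℝ] ℝ} {η₂ : E₂ [⋀^Fin 2]→L[ℝ] ℝ}
    (hη₁ : IsRiemannForm Φ₁ η₁) (hη₂ : IsRiemannForm Φ₂ η₂)
    (hle : ((hodgeGroup Φ₁).prod (hodgeGroup Φ₂)).map (blockDiag ι₁ ι₂) ≤ hodgeGroup (prodPeriod Φ₁ Φ₂)) :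
    blockDiagProd (hodgeGroupC Φ₁) (hodgeGroupC Φ₂) ≤ hodgeGroupC (prodPeriod Φ₁ Φ₂) := by
  rw [← hη₁.zariskiClosureSL_map_hodgeGroup, ← hη₂.zariskiClosureSL_map_hodgeGroup]
  refine blockDiagProd_zariskiClosureSL_le.trans ?_
  rw [blockDiagProd_map_hodgeGroup_eq Φ₁ Φ₂]
  refine zariskiClosureSL_le (isZariskiClosed_hodgeGroupC _) ?_
  refine (Subgroup.map_mono hle).trans ?_
  exact map_hodgeGroup_le_hodgeGroupC _

/-- **(ℝ) ⟹ (ℂ)**: for polarised tori, `Hg(X₁ × X₂)(ℝ) = Hg(X₁)(ℝ) × Hg(X₂)(ℝ)` implies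
`Hg(X₁ × X₂)(ℂ) = Hg(X₁)(ℂ) × Hg(X₂)(ℂ)`. [cite: MoonenZarhin1999LowDim, §3 (3.1)] [cite: Springer1998, §13.3 Cor. 13.3.9 (ii)] -/
theorem IsRiemannForm.hodgeGroupC_prod_eq_of_hodgeGroup_prod_eq {η₁ : E₁ [⋀^Fin 2]→L[ℝ] ℝ} {η₂ : E₂ [⋀^Fin 2]→L[ℝ] ℝ}
    (hη₁ : IsRiemannForm Φ₁ η₁) (hη₂ : IsRiemannForm Φ₂ η₂)
    (h : hodgeGroup (prodPeriod Φ₁ Φ₂) = ((hodgeGroup Φ₁).prod (hodgeGroup Φ₂)).map (blockDiag ι₁ ι₂)) :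
    hodgeGroupC (prodPeriod Φ₁ Φ₂) = blockDiagProd (hodgeGroupC Φ₁) (hodgeGroupC Φ₂) :=
  le_antisymm (hodgeGroupC_prod_le_blockDiagProd Φ₁ Φ₂) (hη₁.blockDiagProd_hodgeGroupC_le_of_prod_le hη₂ h.symm.le)

/-- **(ℂ) ⟹ (ℝ)** (every pair of tori; the tree's finite-index route): complex equality gives index `1`, hence real
equality. [cite: Imai1976HodgeGroups, §2] [cite: MoonenZarhin1999LowDim, §3 (3.1)] -/
theorem hodgeGroup_prod_eq_of_hodgeGroupC_prod_eq
    (h : hodgeGroupC (prodPeriod Φ₁ Φ₂) = blockDiagProd (hodgeGroupC Φ₁) (hodgeGroupC Φ₂)) :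
    hodgeGroup (prodPeriod Φ₁ Φ₂) = ((hodgeGroup Φ₁).prod (hodgeGroup Φ₂)).map (blockDiag ι₁ ι₂) :=
  hodgeGroup_prod_eq_of_relIndex_ne_zero Φ₁ Φ₂ ((hodgeGroupC_prod_eq_blockDiagProd_iff_relIndex_ne_zero Φ₁ Φ₂).1 h)

/-- **(ℂ) ⟺ (ℝ) for polarised tori**: "`Hg(X₁ × X₂) = Hg(X₁) × Hg(X₂)`" means the same on complex and on real points.
[cite: MoonenZarhin1999LowDim, §3 (3.1)] [cite: Springer1998, §13.3 Cor. 13.3.9 (ii)] -/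
theorem IsRiemannForm.hodgeGroupC_prod_eq_iff_hodgeGroup_prod_eq {η₁ : E₁ [⋀^Fin 2]→L[ℝ] ℝ} {η₂ : E₂ [⋀^Fin 2]→L[ℝ] ℝ}
    (hη₁ : IsRiemannForm Φ₁ η₁) (hη₂ : IsRiemannForm Φ₂ η₂) :
    hodgeGroupC (prodPeriod Φ₁ Φ₂) = blockDiagProd (hodgeGroupC Φ₁) (hodgeGroupC Φ₂) ↔
      hodgeGroup (prodPeriod Φ₁ Φ₂) = ((hodgeGroup Φ₁).prod (hodgeGroup Φ₂)).map (blockDiag ι₁ ι₂) :=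
  ⟨hodgeGroup_prod_eq_of_hodgeGroupC_prod_eq, hη₁.hodgeGroupC_prod_eq_of_hodgeGroup_prod_eq hη₂⟩

/-- **(ℝ) ⟺ (fin) for polarised tori**: real equality iff `Hg(X₁ × X₂)(ℂ)` has finite index in `Hg(X₁)(ℂ) × Hg(X₂)(ℂ)`.
[cite: Imai1976HodgeGroups, §2] [cite: MoonenZarhin1999LowDim, §3 (3.1)] -/
theorem IsRiemannForm.hodgeGroup_prod_eq_iff_relIndex_ne_zero {η₁ : E₁ [⋀^Fin 2]→L[ℝ] ℝ} {η₂ : E₂ [⋀^Fin 2]→L[ℝ] ℝ}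
    (hη₁ : IsRiemannForm Φ₁ η₁) (hη₂ : IsRiemannForm Φ₂ η₂) :
    hodgeGroup (prodPeriod Φ₁ Φ₂) = ((hodgeGroup Φ₁).prod (hodgeGroup Φ₂)).map (blockDiag ι₁ ι₂) ↔
      (hodgeGroupC (prodPeriod Φ₁ Φ₂)).relIndex (blockDiagProd (hodgeGroupC Φ₁) (hodgeGroupC Φ₂)) ≠ 0 := by
  rw [← hη₁.hodgeGroupC_prod_eq_iff_hodgeGroup_prod_eq hη₂, hodgeGroupC_prod_eq_blockDiagProd_iff_relIndex_ne_zero]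

end RealToComplex

/-! ## §3 Moonen–Zarhin (3.1) on complex points; exceptional Hodge classes iff infinite index -/

section MoonenZarhin

variable {ι₁ ι₂ : Type*} [Fintype ι₁] [Fintype ι₂] [DecidableEq ι₁] [DecidableEq ι₂]
  {E₁ E₂ : Type*} [NormedAddCommGroup E₁] [NormedSpace ℂ E₁] [NormedAddCommGroup E₂] [NormedSpace ℂ E₂]
  {Φ₁ : (ι₁ → ℝ) ≃L[ℝ] E₁} {Φ₂ : (ι₂ → ℝ) ≃L[ℝ] E₂}

/-- **MOONEN–ZARHIN 1999 (3.1) ON COMPLEX POINTS (polarised tori): `Hg(X₁ × X₂)(ℂ) = Hg(X₁)(ℂ) × Hg(X₂)(ℂ)` iff for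
all `N ≥ 1` and `p` the Hodge classes of `X₁^N × X₂^N` are the `ℚ`-span of the cross products of Hodge classes of `X₁^N`
and `X₂^N`.** [cite: MoonenZarhin1999LowDim, §3 (3.1) (p0006 L57–L62)] -/
theorem IsRiemannForm.hodgeGroupC_prod_eq_iff_forall_hodgeClasses_prod_pow_eq_crossSpan
    {η₁ : E₁ [⋀^Fin 2]→L[ℝ] ℝ} {η₂ : E₂ [⋀^Fin 2]→L[ℝ] ℝ} (hη₁ : IsRiemannForm Φ₁ η₁) (hη₂ : IsRiemannForm Φ₂ η₂) :
    hodgeGroupC (prodPeriod Φ₁ Φ₂) = blockDiagProd (hodgeGroupC Φ₁) (hodgeGroupC Φ₂) ↔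
      ∀ (N p : ℕ), 0 < N →
        hodgeClasses (prodPeriod (powPeriod Φ₁ N) (powPeriod Φ₂ N)) p = crossSpan Φ₁ Φ₂ N p := by
  rw [hη₁.hodgeGroupC_prod_eq_iff_hodgeGroup_prod_eq hη₂]
  exact hodgeGroup_prod_eq_iff_forall_hodgeClasses_prod_pow_eq_crossSpan Φ₁ Φ₂

/-- **(3.1), verbatim negative form on complex points: `Hg(X₁ × X₂)(ℂ) ≠ Hg(X₁)(ℂ) × Hg(X₂)(ℂ)` iff some power
`X₁^N × X₂^N` carries an exceptional Hodge class** (one outside the span of the cross products).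
[cite: MoonenZarhin1999LowDim, §3 (3.1) (p0006 L57–L62)] -/
theorem IsRiemannForm.hodgeGroupC_prod_ne_iff_exists_hodgeClasses_prod_pow_ne_crossSpan
    {η₁ : E₁ [⋀^Fin 2]→L[ℝ] ℝ} {η₂ : E₂ [⋀^Fin 2]→L[ℝ] ℝ} (hη₁ : IsRiemannForm Φ₁ η₁) (hη₂ : IsRiemannForm Φ₂ η₂) :
    hodgeGroupC (prodPeriod Φ₁ Φ₂) ≠ blockDiagProd (hodgeGroupC Φ₁) (hodgeGroupC Φ₂) ↔
      ∃ (N p : ℕ), 0 < N ∧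
        hodgeClasses (prodPeriod (powPeriod Φ₁ N) (powPeriod Φ₂ N)) p ≠ crossSpan Φ₁ Φ₂ N p := by
  rw [Ne, hη₁.hodgeGroupC_prod_eq_iff_forall_hodgeClasses_prod_pow_eq_crossSpan hη₂]
  push Not
  exact Iff.rfl

/-- **EXCEPTIONAL HODGE CLASSES ⟺ INFINITE INDEX (polarised tori)**: `Hg(X₁ × X₂)(ℂ)` has infinite index in
`Hg(X₁)(ℂ) × Hg(X₂)(ℂ)` (`relIndex = 0`) iff some `X₁^N × X₂^N`, `N ≥ 1`, carries an exceptional Hodge class.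
[cite: MoonenZarhin1999LowDim, §3 (3.1)] [cite: Imai1976HodgeGroups, §2] -/
theorem IsRiemannForm.relIndex_hodgeGroupC_prod_eq_zero_iff_exists_exceptional
    {η₁ : E₁ [⋀^Fin 2]→L[ℝ] ℝ} {η₂ : E₂ [⋀^Fin 2]→L[ℝ] ℝ} (hη₁ : IsRiemannForm Φ₁ η₁) (hη₂ : IsRiemannForm Φ₂ η₂) :
    (hodgeGroupC (prodPeriod Φ₁ Φ₂)).relIndex (blockDiagProd (hodgeGroupC Φ₁) (hodgeGroupC Φ₂)) = 0 ↔
      ∃ (N p : ℕ), 0 < N ∧ ∃ γ ∈ hodgeClasses (prodPeriod (powPeriod Φ₁ N) (powPeriod Φ₂ N)) p,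
        γ ∉ crossSpan Φ₁ Φ₂ N p := by
  constructor
  · intro h0
    have hne : hodgeGroup (prodPeriod Φ₁ Φ₂) ≠ ((hodgeGroup Φ₁).prod (hodgeGroup Φ₂)).map (blockDiag ι₁ ι₂) :=
      fun heq ↦ ((hη₁.hodgeGroup_prod_eq_iff_relIndex_ne_zero hη₂).1 heq) h0
    exact exists_hodgeClasses_prod_pow_ne_crossSpan_of_hodgeGroup_prod_ne Φ₁ Φ₂ hne
  · rintro ⟨N, p, hN, γ, hγ, hγnot⟩
    by_contra hne
    have heq := hodgeGroup_prod_eq_of_relIndex_ne_zero Φ₁ Φ₂ hne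
    have hspan := (hodgeGroup_prod_eq_iff_forall_hodgeClasses_prod_pow_eq_crossSpan Φ₁ Φ₂).1 heq N p hN
    exact hγnot (hspan ▸ hγ)

/-- **Finite index ⟺ no exceptional Hodge classes (polarised tori).** [cite: MoonenZarhin1999LowDim, §3 (3.1)] [cite: Imai1976HodgeGroups, §2] -/
theorem IsRiemannForm.relIndex_hodgeGroupC_prod_ne_zero_iff_forall_hodgeClasses_prod_pow_eq_crossSpan
    {η₁ : E₁ [⋀^Fin 2]→L[ℝ] ℝ} {η₂ : E₂ [⋀^Fin 2]→L[ℝ] ℝ} (hη₁ : IsRiemannForm Φ₁ η₁) (hη₂ : IsRiemannForm Φ₂ η₂) :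
    (hodgeGroupC (prodPeriod Φ₁ Φ₂)).relIndex (blockDiagProd (hodgeGroupC Φ₁) (hodgeGroupC Φ₂)) ≠ 0 ↔
      ∀ (N p : ℕ), 0 < N →
        hodgeClasses (prodPeriod (powPeriod Φ₁ N) (powPeriod Φ₂ N)) p = crossSpan Φ₁ Φ₂ N p := by
  rw [← hη₁.hodgeGroup_prod_eq_iff_relIndex_ne_zero hη₂]
  exact hodgeGroup_prod_eq_iff_forall_hodgeClasses_prod_pow_eq_crossSpan Φ₁ Φ₂

/-- **An exceptional Hodge class on some `X₁^N × X₂^N` forces `Hg(X₁ × X₂)(ℂ) ⊊ Hg(X₁)(ℂ) × Hg(X₂)(ℂ)`** (every pair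
of tori; no polarisation needed in this direction). [cite: MoonenZarhin1999LowDim, §3 (3.1)] -/
theorem hodgeGroupC_prod_ne_of_exists_exceptional {N p : ℕ} (hN : 0 < N)
    {γ : ((Fin N → E₁) × (Fin N → E₂)) [⋀^Fin (2 * p)]→L[ℝ] ℂ}
    (hγ : γ ∈ hodgeClasses (prodPeriod (powPeriod Φ₁ N) (powPeriod Φ₂ N)) p) (hγnot : γ ∉ crossSpan Φ₁ Φ₂ N p) :
    hodgeGroupC (prodPeriod Φ₁ Φ₂) ≠ blockDiagProd (hodgeGroupC Φ₁) (hodgeGroupC Φ₂) := by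
  intro heq
  have hreal := hodgeGroup_prod_eq_of_hodgeGroupC_prod_eq heq
  have hspan := (hodgeGroup_prod_eq_iff_forall_hodgeClasses_prod_pow_eq_crossSpan Φ₁ Φ₂).1 hreal N p hN
  exact hγnot (hspan ▸ hγ)

/-- **MZ (3.1) on complex points for abelian varieties.** [cite: MoonenZarhin1999LowDim, §3 (3.1) (p0006 L57–L62)] -/
theorem IsAbelianVariety.hodgeGroupC_prod_eq_iff_forall_hodgeClasses_prod_pow_eq_crossSpan
    (h₁ : IsAbelianVariety Φ₁) (h₂ : IsAbelianVariety Φ₂) :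
    hodgeGroupC (prodPeriod Φ₁ Φ₂) = blockDiagProd (hodgeGroupC Φ₁) (hodgeGroupC Φ₂) ↔
      ∀ (N p : ℕ), 0 < N →
        hodgeClasses (prodPeriod (powPeriod Φ₁ N) (powPeriod Φ₂ N)) p = crossSpan Φ₁ Φ₂ N p := by
  obtain ⟨η₁, hη₁⟩ := h₁
  obtain ⟨η₂, hη₂⟩ := h₂
  exact hη₁.hodgeGroupC_prod_eq_iff_forall_hodgeClasses_prod_pow_eq_crossSpan hη₂

/-- **(ℂ) ⟺ (ℝ) for abelian varieties.** [cite: MoonenZarhin1999LowDim, §3 (3.1)] [cite: Springer1998, §13.3 Cor. 13.3.9 (ii)] -/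
theorem IsAbelianVariety.hodgeGroupC_prod_eq_iff_hodgeGroup_prod_eq (h₁ : IsAbelianVariety Φ₁) (h₂ : IsAbelianVariety Φ₂) :
    hodgeGroupC (prodPeriod Φ₁ Φ₂) = blockDiagProd (hodgeGroupC Φ₁) (hodgeGroupC Φ₂) ↔
      hodgeGroup (prodPeriod Φ₁ Φ₂) = ((hodgeGroup Φ₁).prod (hodgeGroup Φ₂)).map (blockDiag ι₁ ι₂) := by
  obtain ⟨η₁, hη₁⟩ := h₁
  obtain ⟨η₂, hη₂⟩ := h₂
  exact hη₁.hodgeGroupC_prod_eq_iff_hodgeGroup_prod_eq hη₂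

/-- **Exceptional Hodge classes iff infinite index, for abelian varieties.** [cite: MoonenZarhin1999LowDim, §3 (3.1)] [cite: Imai1976HodgeGroups, §2] -/
theorem IsAbelianVariety.relIndex_hodgeGroupC_prod_eq_zero_iff_exists_exceptional
    (h₁ : IsAbelianVariety Φ₁) (h₂ : IsAbelianVariety Φ₂) :
    (hodgeGroupC (prodPeriod Φ₁ Φ₂)).relIndex (blockDiagProd (hodgeGroupC Φ₁) (hodgeGroupC Φ₂)) = 0 ↔
      ∃ (N p : ℕ), 0 < N ∧ ∃ γ ∈ hodgeClasses (prodPeriod (powPeriod Φ₁ N) (powPeriod Φ₂ N)) p,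
        γ ∉ crossSpan Φ₁ Φ₂ N p := by
  obtain ⟨η₁, hη₁⟩ := h₁
  obtain ⟨η₂, hη₂⟩ := h₂
  exact hη₁.relIndex_hodgeGroupC_prod_eq_zero_iff_exists_exceptional hη₂

end MoonenZarhin

/-! ## §4 Consequences read through the complex points (every pair of tori): Künneth spans, dimensions, `D = B` -/

section Consequences

variable {ι₁ ι₂ : Type*} [Fintype ι₁] [Fintype ι₂] [DecidableEq ι₁] [DecidableEq ι₂]
  {E₁ E₂ : Type*} [NormedAddCommGroup E₁] [NormedSpace ℂ E₁] [NormedAddCommGroup E₂] [NormedSpace ℂ E₂]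
  {Φ₁ : (ι₁ → ℝ) ≃L[ℝ] E₁} {Φ₂ : (ι₂ → ℝ) ≃L[ℝ] E₂}

/-- `Hg(X₁ × X₂)(ℂ) = Hg(X₁)(ℂ) × Hg(X₂)(ℂ)` gives the real inclusion `Hg(X₁)(ℝ) × Hg(X₂)(ℝ) ≤ Hg(X₁ × X₂)(ℝ)` — the
hypothesis of the tree's Künneth theorems (`ComplexTorusHodgeClassesProductHodgeGroup`); every pair of tori.
[cite: Imai1976HodgeGroups, §2] [cite: MoonenZarhin1999LowDim, §3 (3.1)] -/
theorem prod_le_hodgeGroup_of_hodgeGroupC_prod_eq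
    (h : hodgeGroupC (prodPeriod Φ₁ Φ₂) = blockDiagProd (hodgeGroupC Φ₁) (hodgeGroupC Φ₂)) :
    ((hodgeGroup Φ₁).prod (hodgeGroup Φ₂)).map (blockDiag ι₁ ι₂) ≤ hodgeGroup (prodPeriod Φ₁ Φ₂) :=
  (hodgeGroup_prod_eq_of_hodgeGroupC_prod_eq h).ge

/-- Finite index of `Hg(X₁ × X₂)(ℂ)` in `Hg(X₁)(ℂ) × Hg(X₂)(ℂ)` gives the real inclusion (Imai's route; every pair of
tori). [cite: Imai1976HodgeGroups, §2] -/
theorem prod_le_hodgeGroup_of_relIndex_ne_zero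
    (h : (hodgeGroupC (prodPeriod Φ₁ Φ₂)).relIndex (blockDiagProd (hodgeGroupC Φ₁) (hodgeGroupC Φ₂)) ≠ 0) :
    ((hodgeGroup Φ₁).prod (hodgeGroup Φ₂)).map (blockDiag ι₁ ι₂) ≤ hodgeGroup (prodPeriod Φ₁ Φ₂) :=
  (hodgeGroup_prod_eq_of_relIndex_ne_zero Φ₁ Φ₂ h).ge

/-- **MZ (3.1) "⟹" on complex points, `N = 1`: if `Hg(X₁ × X₂)(ℂ) = Hg(X₁)(ℂ) × Hg(X₂)(ℂ)` then
`B^p(X₁ × X₂) = Σ_{a+b=p} B^a(X₁) ⊗ B^b(X₂)`** (the Hodge classes of the product are spanned by cross products of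
Hodge classes of the factors; every pair of tori). [cite: MoonenZarhin1999LowDim, §3 (3.1)] [cite: Imai1976HodgeGroups, §2] -/
theorem hodgeClasses_prod_eq_span_cross_of_hodgeGroupC_prod_eq
    (h : hodgeGroupC (prodPeriod Φ₁ Φ₂) = blockDiagProd (hodgeGroupC Φ₁) (hodgeGroupC Φ₂)) (p : ℕ) :
    hodgeClasses (prodPeriod Φ₁ Φ₂) p = Submodule.span ℚ
      {x | ∃ (a b : ℕ) (h : 2 * a + 2 * b = 2 * p) (γ : E₁ [⋀^Fin (2 * a)]→L[ℝ] ℂ) (δ : E₂ [⋀^Fin (2 * b)]→L[ℝ] ℂ),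
        γ ∈ hodgeClasses Φ₁ a ∧ δ ∈ hodgeClasses Φ₂ b ∧
          x = ((γ.compContinuousLinearMap (ContinuousLinearMap.fst ℝ E₁ E₂)).wedge
            (δ.compContinuousLinearMap (ContinuousLinearMap.snd ℝ E₁ E₂))).domDomCongr (finCongr h)} :=
  hodgeClasses_prod_eq_span_cross_of_prod_le_hodgeGroup Φ₁ Φ₂ (prod_le_hodgeGroup_of_hodgeGroupC_prod_eq h) p

/-- **`dim B^p(X₁ × X₂) = Σ_{a+b=p} dim B^a(X₁) · dim B^b(X₂)` under `Hg(X₁ × X₂)(ℂ) = Hg(X₁)(ℂ) × Hg(X₂)(ℂ)`**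
(every pair of tori). [cite: MoonenZarhin1999LowDim, §3 (3.1)] [cite: Imai1976HodgeGroups, §2] -/
theorem finrank_hodgeClasses_prod_eq_sum_of_hodgeGroupC_prod_eq
    (h : hodgeGroupC (prodPeriod Φ₁ Φ₂) = blockDiagProd (hodgeGroupC Φ₁) (hodgeGroupC Φ₂)) (p : ℕ) :
    Module.finrank ℚ (hodgeClasses (prodPeriod Φ₁ Φ₂) p) =
      ∑ ab ∈ Finset.HasAntidiagonal.antidiagonal p,
        Module.finrank ℚ (hodgeClasses Φ₁ ab.1) * Module.finrank ℚ (hodgeClasses Φ₂ ab.2) :=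
  finrank_hodgeClasses_prod_eq_sum_of_prod_le_hodgeGroup Φ₁ Φ₂ (prod_le_hodgeGroup_of_hodgeGroupC_prod_eq h) p

/-- **`D = B` transfers to the product under `Hg(X₁ × X₂)(ℂ) = Hg(X₁)(ℂ) × Hg(X₂)(ℂ)`**: if every Hodge class of `X₁`
and of `X₂` is a divisor class (a polynomial in divisor classes), so is every Hodge class of `X₁ × X₂` (every pair
of tori). [cite: MoonenZarhin1999LowDim, §3 (3.1)] [cite: Imai1976HodgeGroups, §2 (Theorem)] -/
theorem forall_divisorClasses_prod_eq_hodgeClasses_of_hodgeGroupC_prod_eq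
    (h : hodgeGroupC (prodPeriod Φ₁ Φ₂) = blockDiagProd (hodgeGroupC Φ₁) (hodgeGroupC Φ₂))
    (h₁ : ∀ a, divisorClasses Φ₁ a = hodgeClasses Φ₁ a) (h₂ : ∀ b, divisorClasses Φ₂ b = hodgeClasses Φ₂ b) (p : ℕ) :
    divisorClasses (prodPeriod Φ₁ Φ₂) p = hodgeClasses (prodPeriod Φ₁ Φ₂) p :=
  forall_divisorClasses_prod_eq_hodgeClasses_of_prod_le_hodgeGroup Φ₁ Φ₂
    (prod_le_hodgeGroup_of_hodgeGroupC_prod_eq h) h₁ h₂ p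

/-- **Imai's theorem-shape: finite index of `Hg(X₁ × X₂)(ℂ)` in `Hg(X₁)(ℂ) × Hg(X₂)(ℂ)` and `D = B` on both factors
give `D = B` on `X₁ × X₂`** (every pair of tori). [cite: Imai1976HodgeGroups, §2 (Theorem)] [cite: MoonenZarhin1999LowDim, §3 (3.1)] -/
theorem forall_divisorClasses_prod_eq_hodgeClasses_of_relIndex_ne_zero
    (h : (hodgeGroupC (prodPeriod Φ₁ Φ₂)).relIndex (blockDiagProd (hodgeGroupC Φ₁) (hodgeGroupC Φ₂)) ≠ 0)
    (h₁ : ∀ a, divisorClasses Φ₁ a = hodgeClasses Φ₁ a) (h₂ : ∀ b, divisorClasses Φ₂ b = hodgeClasses Φ₂ b) (p : ℕ) :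
    divisorClasses (prodPeriod Φ₁ Φ₂) p = hodgeClasses (prodPeriod Φ₁ Φ₂) p :=
  forall_divisorClasses_prod_eq_hodgeClasses_of_prod_le_hodgeGroup Φ₁ Φ₂
    (prod_le_hodgeGroup_of_relIndex_ne_zero h) h₁ h₂ p

/-- **Polarised tori: real equality `Hg(X₁ × X₂)(ℝ) = Hg(X₁)(ℝ) × Hg(X₂)(ℝ)` already forces no exceptional Hodge
classes on ANY `X₁^N × X₂^N` and finite (indeed trivial) index on complex points** — the three readings packaged.
[cite: MoonenZarhin1999LowDim, §3 (3.1)] [cite: Springer1998, §13.3 Cor. 13.3.9 (ii)] -/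
theorem IsRiemannForm.relIndex_ne_zero_and_forall_hodgeClasses_prod_pow_eq_crossSpan_of_prod_le
    {η₁ : E₁ [⋀^Fin 2]→L[ℝ] ℝ} {η₂ : E₂ [⋀^Fin 2]→L[ℝ] ℝ} (hη₁ : IsRiemannForm Φ₁ η₁) (hη₂ : IsRiemannForm Φ₂ η₂)
    (hle : ((hodgeGroup Φ₁).prod (hodgeGroup Φ₂)).map (blockDiag ι₁ ι₂) ≤ hodgeGroup (prodPeriod Φ₁ Φ₂)) :
    (hodgeGroupC (prodPeriod Φ₁ Φ₂)).relIndex (blockDiagProd (hodgeGroupC Φ₁) (hodgeGroupC Φ₂)) ≠ 0 ∧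
      ∀ (N p : ℕ), 0 < N →
        hodgeClasses (prodPeriod (powPeriod Φ₁ N) (powPeriod Φ₂ N)) p = crossSpan Φ₁ Φ₂ N p := by
  have heq : hodgeGroup (prodPeriod Φ₁ Φ₂) = ((hodgeGroup Φ₁).prod (hodgeGroup Φ₂)).map (blockDiag ι₁ ι₂) :=
    le_antisymm (hodgeGroup_prod_le Φ₁ Φ₂) hle
  exact ⟨(hη₁.hodgeGroup_prod_eq_iff_relIndex_ne_zero hη₂).1 heq,
    (hodgeGroup_prod_eq_iff_forall_hodgeClasses_prod_pow_eq_crossSpan Φ₁ Φ₂).1 heq⟩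

end Consequences

end ComplexTorus

end Literature.Geometry.Kaehler
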